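import Summits.BirchSwinnertonDyer.BirchSwinnertonDyer.Theorems.PrintCf2RubinValueTwoColemanCoinvariantCharTrace
import Summits.BirchSwinnertonDyer.BirchSwinnertonDyer.Theorems.PrintCf2RubinValueTwoColemanCoinvariantCharArtin
import HarnessLib

/-!
# Brick (c) at `p = 2`, local `χ`-part ON THE `ℤ/d`-TRACE (any `d`) — generated form `𝒞̄ = closure ⟨β_c^{±1}⟩` and the CAPSTONE for
# Artin-symbol index families from the PRODUCT RULE `σ̃_a·β_c = β_{μ(a,c)}·(β_a⁻¹)^{n_c}`: **`char_Λ ((N_Σ / Col_Σ 𝒞̄)_ε) = (L_ε)`**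

Cell `bsd-print-cf2`, width seat `bsd-line-cf2c-w7` g17, route C `PrintCf2RubinValueTwo`, crux of record stmt-BirchSwinnertonDyer-24033
`TwoVariableMainConjAtSplitTwoQuad` (23720 nominal), BRICK §4(c); `--supports` the crux as a helper.  THEOREMS ONLY (0 sorry, no named fact, no
definition); Theses-free.  BSD is not proved by any of this.

The `d`-general (trace) versions of `ColemanCoinvariantGalois` §4 and `ColemanCoinvariantArtin` §2 (g14 S24/S27, which carry `[Unique (ZMod d)]`):
same proofs, with `N`, `Col C`, `Col β_c(default)` replaced by their `ℤ/d`-traces `N_Σ`, `Col_Σ C`, `Σ_j Col β_c(j)` in `M₁`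
(`PrintCf2RubinValueTwoColemanCoinvariantCharTrace`, `LubinTateColemanUnitsImageTraceTwo`, `PAdicTwoVariableColemanImageCocycleOfUnitsTrace`):

* §1 ★★★ `charIdeal_coinvariants_colemanImageTrace_closure_eq_span_of_galois` / ★★ `exists_…` — generated form, `𝒞̄ = closure ⟨β_c^{±1}⟩` with all
  `Γ_F`-translates of the generators in `𝒞̄`;
* §2 ★★★ **`charIdeal_coinvariants_colemanImageTrace_closure_eq_span_of_mul_rule`** / ★★ `exists_…` — from principal coherent families `β_c`, indices
  `σ̃_c ∈ Γ_F` with Amice pairs satisfying the product rule (`μ` commutative) and approximating every `σ ∈ Γ_F` on every layer `E_N·K_π^{N+1}`,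
  `χ_π(σ̃_{a₁}) = γ`, `π ∣ n_{a₁} − 1`, one `a₂`, and `L_ε ≠ 0` with `φ_ε(Σ Col β_c) = (t_{χ(σ̃_c)}·C g_c − C n_c)·L_ε`.

## References
* [deShalit1987] E. de Shalit, *Iwasawa theory of elliptic curves with complex multiplication* (1987), II §2.4 (ii), §4.11 (p. 66), §4.12 (29)–(33),
  §4.14; III §1.4 (5), Cor. 1.5 (7), Lemma 1.10 (17).
* [Washington1997] L. C. Washington, *Introduction to Cyclotomic Fields* (1997), §13.2.
* [Matsumura1987] H. Matsumura, *Commutative Ring Theory* (1986), Thm. 20.3.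
-/

noncomputable section

set_option linter.dupNamespace false
set_option autoImplicit false

open Filter Topology
open scoped PowerSeries.WithPiTopology

namespace Summit.BirchSwinnertonDyer.BirchSwinnertonDyer.Theorems.PrintCf2.ColemanCoinvariantTraceArtin

open Literature.NumberTheory.GaloisRepresentations Literature.NumberTheory.GaloisRepresentations.IsNonarchimedeanLocalField
  Literature.NumberTheory.GaloisRepresentations.LubinTate ValuativeRel Field
open Literature.NumberTheory.EllipticCurves
open Literature.RingTheory.PowerSeries (maxEval)
open Summit.BirchSwinnertonDyer.BirchSwinnertonDyer.Theorems.PrintCf2.ColemanImage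
open Summit.BirchSwinnertonDyer.BirchSwinnertonDyer.Theorems.PrintCf2.ColemanCoinvariantGalois
open Summit.BirchSwinnertonDyer.BirchSwinnertonDyer.Theorems.PrintCf2.ColemanCoinvariantArtin
open Summit.BirchSwinnertonDyer.BirchSwinnertonDyer.Theorems.PrintCf2.ColemanCoinvariantTrace

variable {F : Type} [Field F] [ValuativeRel F] [TopologicalSpace F] [IsNonarchimedeanLocalField F]

attribute [local instance] ltNormUniformSpace ltNormIsUniformAddGroup rk1 nF nE fintypeResidueField
attribute [local instance] RelNormCoherentUnits.instCommMonoid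
attribute [local instance] isAdicComplete_maximalIdeal_powerSeries_integer

variable {p : ℕ} [hp : Fact p.Prime] {d : ℕ} (hd : d.Coprime p)
variable {π : 𝒪[F]} (hπ : (valuation F).IsUniformizer (π : F))
variable (E : ℕ → IntermediateField F (AlgebraicClosure F)) [∀ m, FiniteDimensional F (E m)] [∀ m, Normal F (E m)]
  [∀ m, IsGalois F (E m)] (hmono : Monotone E) (hE : ∀ m, E m ≤ maxUnramified F) (hdeg : ∀ m, Module.finrank F (E m) = d * p ^ m)
  {σ₀ : absoluteGaloisGroup F} (hσ₀ : IsAbsArithFrob σ₀) (hq : residueFieldCard F = 2)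
variable (u : (LTCoeff F)ˣ) (hu : LTCoeff.of F π = residueFieldCard F * u) (γ w : 𝒪[F]ˣ) (hγ : (γ : 𝒪[F]) = 1 + π ^ 2 * w)
variable [IsAdicComplete (Ideal.span {intBase F (LTCoeff.of F π)}) (PowerSeries 𝒪[F])] [NeZero d]
variable {θ : ∀ m, unitBall (E m)} (hθ : ∀ m, IsIntegralNormalGen (E m) (θ m))
  (hcoh : ∀ m, unitBallTrace (hmono (Nat.le_succ m)) (θ (m + 1)) = θ m)
variable [CharZero F] [IsAdicComplete (Ideal.span {(p : 𝒪[F])}) 𝒪[F]] (hI : Ideal.span {(p : 𝒪[F])} ≠ ⊤)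
  (hud : ∀ m, (u : LTCoeff F) ^ Module.finrank F (E m) ≠ 1) (hm : ∃ m₁ : ℕ, LTCoeff.of F π ^ 2 ∣ LTCoeff.of F π - m₁)
variable (hN : DenseRange (Nat.cast : ℕ → 𝒪[F]))
variable {I : Type*} (β : I → ∀ m, RelNormCoherentUnits hπ (E m)) (hβ : ∀ c, β c ∈ principalCoherentFamilies hπ E hmono)
variable (ε : PowerSeries (PowerSeries 𝒪[F])) (σ : I → absoluteGaloisGroup F) (g : I → (PowerSeries 𝒪[F])ˣ) (n : I → ℕ)

/-! ## §1. The generated form `𝒞̄ = closure ⟨β_c^{±1}⟩` on the trace -/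

section Generated

variable (hgen : ∀ (τ : absoluteGaloisGroup F) (c : I), (fun m => ((β c) m).galAct τ) ∈
    closure (Submonoid.closure (Set.range β ∪ Set.range fun c => fun m => ((β c) m).inv hπ (E m)) : Set (∀ m, RelNormCoherentUnits hπ (E m))))

include hdeg hE hσ₀ hcoh hm in
/-- ★★★ **THE LOCAL (c)-IDENTITY ON THE TRACE, generated form, any `d`** (de Shalit III Lemma 1.10 (17) at `q = 2`, one prime, `χ` trivial on `ℤ/d`,
`χ(−1) = ε`): `𝒞̄ = closure ⟨β_c^{±1}⟩` with all Galois translates of the generators in `𝒞̄`; indices `σ̃_c ∈ Γ_F` with Amice units `g_c`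
(arbitrary action on `E_∞`); `χ_π(σ̃_{a₁}) = γ`; `b = n_{a₁} g_{a₁}⁻¹ − 1 ∈ 𝔪`; one `a₂`; `L_ε ≠ 0` with `φ_ε(Σ Col β_c) = (t_{χ(σ̃_c)}·C g_c − C n_c)·L_ε`.
Then **`char_Λ ((N_Σ / Col_Σ 𝒞̄)_ε) = (L_ε)`**. [cite: deShalit1987, III §1.4 (5), Cor. 1.5 (7), Lemma 1.10 (17); II §4.12 (33), §4.14] [cite: Matsumura1987, Thm. 20.3] -/
theorem charIdeal_coinvariants_colemanImageTrace_closure_eq_span_of_galois (hε : ε * ε = 1)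
    (a₁ a₂ : I) (hv₁ : lubinTateChar hπ (σ a₁) = γ)
    (hn₁ : ((n a₁ : ℕ) : PowerSeries 𝒪[F]) * ((g a₁)⁻¹ : (PowerSeries 𝒪[F])ˣ) - 1 ∈ IsLocalRing.maximalIdeal (PowerSeries 𝒪[F]))
    (ha₂ : maxEval hn₁ (colemanDeltaCoinvFun hπ hq (intBase F) u hu γ (eq_zero_of_C_pi_mul_eq_zero_integer hπ) w hγ ε
        (unitTwistₗ hπ hq (intBase F) u hu γ (lubinTateChar hπ (σ a₂)) (TActModule.ofPS _ _ 1)) -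
      PowerSeries.C (((n a₂ : ℕ) : PowerSeries 𝒪[F]) * ((g a₂)⁻¹ : (PowerSeries 𝒪[F])ˣ))) ≠ 0)
    (L : PowerSeries (PowerSeries 𝒪[F])) (hL0 : L ≠ 0)
    (hL : ∀ c : I, colemanDeltaCoinvFun hπ hq (intBase F) u hu γ (eq_zero_of_C_pi_mul_eq_zero_integer hπ) w hγ ε
        (indexTraceₗ hπ hq u hu γ (colemanImage hd hπ E hmono hE hdeg hσ₀ hq u hu γ hθ hcoh
          (closure_unitsGen_subset_principalCoherentFamilies hπ E hmono β hβ (mem_closure_unitsGen hπ E β c)).1)) =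
      (colemanDeltaCoinvFun hπ hq (intBase F) u hu γ (eq_zero_of_C_pi_mul_eq_zero_integer hπ) w hγ ε
          (unitTwistₗ hπ hq (intBase F) u hu γ (lubinTateChar hπ (σ c)) (TActModule.ofPS _ _ 1)) *
          PowerSeries.C (g c : PowerSeries 𝒪[F]) - PowerSeries.C ((n c : ℕ) : PowerSeries 𝒪[F])) * L) :
    Module.charIdeal (PowerSeries (PowerSeries 𝒪[F]))
        (↥(unitsImageTrace hd hπ E hmono hE hdeg hσ₀ hq u hu γ hθ hcoh hI hud) ⧸
          colemanCoinvRel hπ hq (intBase F) u hu γ ε (unitsImageTrace hd hπ E hmono hE hdeg hσ₀ hq u hu γ hθ hcoh hI hud)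
            (fun _ hG => unitTwistₗ_mem_unitsImageTrace hd hπ E hmono hE hdeg hσ₀ hq u hu γ hθ hcoh hI hud (-1) hG)
            (colemanImageTrace hd hπ E hmono hE hdeg hσ₀ hq u hu γ hθ hcoh hN
              (closure (Submonoid.closure (Set.range β ∪ Set.range fun c => fun m => ((β c) m).inv hπ (E m)) :
                Set (∀ m, RelNormCoherentUnits hπ (E m))))
              isClosed_closure (closure_unitsGen_subset_principalCoherentFamilies hπ E hmono β hβ) (one_mem_closure_unitsGen hπ E β)
              (mul_mem_closure_unitsGen hπ E β) (inv_mem_closure_unitsGen hπ E β) (galAct_mem_closure_unitsGen hπ E β hgen))) =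
      Ideal.span {L} :=
  charIdeal_coinvariants_colemanImageTrace_eq_span_of_galois hd hπ E hmono hE hdeg hσ₀ hq u hu γ w hγ hθ hcoh hI hud hm hN _ isClosed_closure
    (closure_unitsGen_subset_principalCoherentFamilies hπ E hmono β hβ) (one_mem_closure_unitsGen hπ E β)
    (mul_mem_closure_unitsGen hπ E β) (inv_mem_closure_unitsGen hπ E β) (galAct_mem_closure_unitsGen hπ E β hgen) β
    (mem_closure_unitsGen hπ E β) ε σ g n hε subset_rfl a₁ a₂ hv₁ hn₁ ha₂ L hL0 hL

include hdeg hE hσ₀ hcoh hm in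
/-- ★★ **Existence form, generated, any `d`**: under the LEVELWISE relation for arbitrary Galois indices (II §2.4 (ii) with local lifts of the Artin
symbols) and the two auxiliary indices, THE series `L_ε` exists with `φ_ε(Σ Col β_c) = (t_{χ(σ̃_c)}·C g_c − C n_c)·L_ε`, and — if `L_ε ≠ 0` —
**`char_Λ ((N_Σ / Col_Σ 𝒞̄)_ε) = (L_ε)`**. [cite: deShalit1987, II §2.4 (ii), §4.12 (29)–(33), §4.14; III §1.4 (5), Lemma 1.10 (17)] [cite: Matsumura1987, Thm. 20.3] -/
theorem exists_charIdeal_coinvariants_colemanImageTrace_closure_eq_span_of_galois (hε : ε * ε = 1) (s : I → ZMod d)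
    (hg : ∀ i m, ∃ a : ℕ, (∀ x : E m, σ i • (x : AlgebraicClosure F) = (σ₀ ^ a) • (x : AlgebraicClosure F)) ∧
      ((1 + PowerSeries.X : PowerSeries 𝒪[F]) ^ p ^ m - 1) ∣ (g i : PowerSeries 𝒪[F]) - (1 + PowerSeries.X) ^ a ∧ (a : ZMod d) = s i)
    (hrel : ∀ (a c : I) (m : ℕ), ((β a) m).galAct (σ c) * (β c) m ^ n a = ((β c) m).galAct (σ a) * (β a) m ^ n c)
    (a₁ a₂ : I) (hv₁ : lubinTateChar hπ (σ a₁) = γ) (hn₁ : (π : 𝒪[F]) ∣ (n a₁ : 𝒪[F]) - 1)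
    (ha₂ : maxEval (natCast_mul_inv_sub_one_mem_maximalIdeal hπ hn₁ (g a₁) (constantCoeff_eq_one_of_amice E (p := p) (hg a₁)))
      (colemanDeltaCoinvFun hπ hq (intBase F) u hu γ (eq_zero_of_C_pi_mul_eq_zero_integer hπ) w hγ ε
          (unitTwistₗ hπ hq (intBase F) u hu γ (lubinTateChar hπ (σ a₂)) (TActModule.ofPS _ _ 1)) -
        PowerSeries.C (((n a₂ : ℕ) : PowerSeries 𝒪[F]) * ((g a₂)⁻¹ : (PowerSeries 𝒪[F])ˣ))) ≠ 0) :
    ∃ L : PowerSeries (PowerSeries 𝒪[F]),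
      (∀ c : I, colemanDeltaCoinvFun hπ hq (intBase F) u hu γ (eq_zero_of_C_pi_mul_eq_zero_integer hπ) w hγ ε
          (indexTraceₗ hπ hq u hu γ (colemanImage hd hπ E hmono hE hdeg hσ₀ hq u hu γ hθ hcoh
            (closure_unitsGen_subset_principalCoherentFamilies hπ E hmono β hβ (mem_closure_unitsGen hπ E β c)).1)) =
        (colemanDeltaCoinvFun hπ hq (intBase F) u hu γ (eq_zero_of_C_pi_mul_eq_zero_integer hπ) w hγ ε
            (unitTwistₗ hπ hq (intBase F) u hu γ (lubinTateChar hπ (σ c)) (TActModule.ofPS _ _ 1)) *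
            PowerSeries.C (g c : PowerSeries 𝒪[F]) - PowerSeries.C ((n c : ℕ) : PowerSeries 𝒪[F])) * L) ∧
      (L ≠ 0 → Module.charIdeal (PowerSeries (PowerSeries 𝒪[F]))
          (↥(unitsImageTrace hd hπ E hmono hE hdeg hσ₀ hq u hu γ hθ hcoh hI hud) ⧸
            colemanCoinvRel hπ hq (intBase F) u hu γ ε (unitsImageTrace hd hπ E hmono hE hdeg hσ₀ hq u hu γ hθ hcoh hI hud)
              (fun _ hG => unitTwistₗ_mem_unitsImageTrace hd hπ E hmono hE hdeg hσ₀ hq u hu γ hθ hcoh hI hud (-1) hG)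
              (colemanImageTrace hd hπ E hmono hE hdeg hσ₀ hq u hu γ hθ hcoh hN
                (closure (Submonoid.closure (Set.range β ∪ Set.range fun c => fun m => ((β c) m).inv hπ (E m)) :
                  Set (∀ m, RelNormCoherentUnits hπ (E m))))
                isClosed_closure (closure_unitsGen_subset_principalCoherentFamilies hπ E hmono β hβ) (one_mem_closure_unitsGen hπ E β)
                (mul_mem_closure_unitsGen hπ E β) (inv_mem_closure_unitsGen hπ E β) (galAct_mem_closure_unitsGen hπ E β hgen))) =
        Ideal.span {L}) :=
  exists_charIdeal_coinvariants_colemanImageTrace_eq_span_of_galois hd hπ E hmono hE hdeg hσ₀ hq u hu γ w hγ hθ hcoh hI hud hm hN _ isClosed_closure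
    (closure_unitsGen_subset_principalCoherentFamilies hπ E hmono β hβ) (one_mem_closure_unitsGen hπ E β)
    (mul_mem_closure_unitsGen hπ E β) (inv_mem_closure_unitsGen hπ E β) (galAct_mem_closure_unitsGen hπ E β hgen) β
    (mem_closure_unitsGen hπ E β) ε σ g n hε subset_rfl s hg hrel a₁ a₂ hv₁ hn₁ ha₂

end Generated

/-! ## §2. The capstone from the product rule, on the trace -/

section MulRule

variable (μ : I → I → I) (hμ : ∀ a c, μ a c = μ c a)
  (hrule : ∀ a c : I, (fun m => ((β c) m).galAct (σ a)) = β (μ a c) * (fun m => ((β a) m).inv hπ (E m)) ^ n c)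
  (happrox : ∀ (τ : absoluteGaloisGroup F) (N : ℕ), ∃ a : I, ∀ z : (E N ⊔ ltField π N : IntermediateField F (AlgebraicClosure F)),
    σ a • (z : AlgebraicClosure F) = τ • (z : AlgebraicClosure F))

include hdeg hE hσ₀ hcoh hm hrule happrox in
/-- ★★★ **THE LOCAL (c)-IDENTITY FROM THE PRODUCT RULE, ON THE TRACE, ANY `d`** (de Shalit III Lemma 1.10 (17) at `q = 2`, one prime, `χ` trivial
on `ℤ/d`, `χ(−1) = ε`, for Artin-symbol index families): `β_c ∈ 𝒰¹_∞` principal coherent; `σ̃_c ∈ Γ_F` with Amice units `g_c`, satisfying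
`σ̃_a·β_c = β_{μ(a,c)}·(β_a⁻¹)^{n_c}` (`μ` commutative) and approximating every `σ ∈ Γ_F` on every layer `E_N·K_π^{N+1}`; `χ_π(σ̃_{a₁}) = γ`;
`b = n_{a₁} g_{a₁}⁻¹ − 1 ∈ 𝔪`; one `a₂` with non-zero Weierstrass value; `L_ε ≠ 0` with `φ_ε(Σ Col β_c) = (t_{χ(σ̃_c)}·C g_c − C n_c)·L_ε`.  Then
**`char_Λ ((N_Σ / Col_Σ 𝒞̄)_ε) = (L_ε)`**, `𝒞̄ = closure ⟨β_c^{±1}⟩`. [cite: deShalit1987, II §2.4 (ii), §4.12 (33), §4.14; III §1.4 (5), Cor. 1.5 (7), Lemma 1.10 (17)]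
[cite: Washington1997, §13.2] -/
theorem charIdeal_coinvariants_colemanImageTrace_closure_eq_span_of_mul_rule (hε : ε * ε = 1)
    (a₁ a₂ : I) (hv₁ : lubinTateChar hπ (σ a₁) = γ)
    (hn₁ : ((n a₁ : ℕ) : PowerSeries 𝒪[F]) * ((g a₁)⁻¹ : (PowerSeries 𝒪[F])ˣ) - 1 ∈ IsLocalRing.maximalIdeal (PowerSeries 𝒪[F]))
    (ha₂ : maxEval hn₁ (colemanDeltaCoinvFun hπ hq (intBase F) u hu γ (eq_zero_of_C_pi_mul_eq_zero_integer hπ) w hγ ε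
        (unitTwistₗ hπ hq (intBase F) u hu γ (lubinTateChar hπ (σ a₂)) (TActModule.ofPS _ _ 1)) -
      PowerSeries.C (((n a₂ : ℕ) : PowerSeries 𝒪[F]) * ((g a₂)⁻¹ : (PowerSeries 𝒪[F])ˣ))) ≠ 0)
    (L : PowerSeries (PowerSeries 𝒪[F])) (hL0 : L ≠ 0)
    (hL : ∀ c : I, colemanDeltaCoinvFun hπ hq (intBase F) u hu γ (eq_zero_of_C_pi_mul_eq_zero_integer hπ) w hγ ε
        (indexTraceₗ hπ hq u hu γ (colemanImage hd hπ E hmono hE hdeg hσ₀ hq u hu γ hθ hcoh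
          (closure_unitsGen_subset_principalCoherentFamilies hπ E hmono β hβ (mem_closure_unitsGen hπ E β c)).1)) =
      (colemanDeltaCoinvFun hπ hq (intBase F) u hu γ (eq_zero_of_C_pi_mul_eq_zero_integer hπ) w hγ ε
          (unitTwistₗ hπ hq (intBase F) u hu γ (lubinTateChar hπ (σ c)) (TActModule.ofPS _ _ 1)) *
          PowerSeries.C (g c : PowerSeries 𝒪[F]) - PowerSeries.C ((n c : ℕ) : PowerSeries 𝒪[F])) * L) :
    Module.charIdeal (PowerSeries (PowerSeries 𝒪[F]))
        (↥(unitsImageTrace hd hπ E hmono hE hdeg hσ₀ hq u hu γ hθ hcoh hI hud) ⧸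
          colemanCoinvRel hπ hq (intBase F) u hu γ ε (unitsImageTrace hd hπ E hmono hE hdeg hσ₀ hq u hu γ hθ hcoh hI hud)
            (fun _ hG => unitTwistₗ_mem_unitsImageTrace hd hπ E hmono hE hdeg hσ₀ hq u hu γ hθ hcoh hI hud (-1) hG)
            (colemanImageTrace hd hπ E hmono hE hdeg hσ₀ hq u hu γ hθ hcoh hN
              (closure (Submonoid.closure (Set.range β ∪ Set.range fun c => fun m => ((β c) m).inv hπ (E m)) :
                Set (∀ m, RelNormCoherentUnits hπ (E m))))
              isClosed_closure (closure_unitsGen_subset_principalCoherentFamilies hπ E hmono β hβ) (one_mem_closure_unitsGen hπ E β)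
              (mul_mem_closure_unitsGen hπ E β) (inv_mem_closure_unitsGen hπ E β)
              (galAct_mem_closure_unitsGen hπ E β (galAct_mem_closure_unitsGen_of_mul_rule hπ E hmono β σ happrox μ n hrule)))) =
      Ideal.span {L} :=
  charIdeal_coinvariants_colemanImageTrace_closure_eq_span_of_galois hd hπ E hmono hE hdeg hσ₀ hq u hu γ w hγ hθ hcoh hI hud hm hN β hβ ε σ g n
    (galAct_mem_closure_unitsGen_of_mul_rule hπ E hmono β σ happrox μ n hrule) hε a₁ a₂ hv₁ hn₁ ha₂ L hL0 hL

include hdeg hE hσ₀ hcoh hm hμ hrule happrox in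
/-- ★★ **Existence form from the product rule, on the trace, any `d`**: with Amice pairs `(g_c, s_c)` of the `σ̃_c`, `χ_π(σ̃_{a₁}) = γ`,
`π ∣ n_{a₁} − 1` and one `a₂`, THE series `L_ε` exists with `φ_ε(Σ Col β_c) = (t_{χ(σ̃_c)}·C g_c − C n_c)·L_ε`, and — if `L_ε ≠ 0` —
**`char_Λ ((N_Σ / Col_Σ 𝒞̄)_ε) = (L_ε)`**. [cite: deShalit1987, II §2.4 (ii), §4.12 (29)–(33), §4.14; III §1.4 (5), Lemma 1.10 (17)] -/
theorem exists_charIdeal_coinvariants_colemanImageTrace_closure_eq_span_of_mul_rule (hε : ε * ε = 1) (s : I → ZMod d)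
    (hg : ∀ i m, ∃ a : ℕ, (∀ x : E m, σ i • (x : AlgebraicClosure F) = (σ₀ ^ a) • (x : AlgebraicClosure F)) ∧
      ((1 + PowerSeries.X : PowerSeries 𝒪[F]) ^ p ^ m - 1) ∣ (g i : PowerSeries 𝒪[F]) - (1 + PowerSeries.X) ^ a ∧ (a : ZMod d) = s i)
    (a₁ a₂ : I) (hv₁ : lubinTateChar hπ (σ a₁) = γ) (hn₁ : (π : 𝒪[F]) ∣ (n a₁ : 𝒪[F]) - 1)
    (ha₂ : maxEval (natCast_mul_inv_sub_one_mem_maximalIdeal hπ hn₁ (g a₁) (constantCoeff_eq_one_of_amice E (p := p) (hg a₁)))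
      (colemanDeltaCoinvFun hπ hq (intBase F) u hu γ (eq_zero_of_C_pi_mul_eq_zero_integer hπ) w hγ ε
          (unitTwistₗ hπ hq (intBase F) u hu γ (lubinTateChar hπ (σ a₂)) (TActModule.ofPS _ _ 1)) -
        PowerSeries.C (((n a₂ : ℕ) : PowerSeries 𝒪[F]) * ((g a₂)⁻¹ : (PowerSeries 𝒪[F])ˣ))) ≠ 0) :
    ∃ L : PowerSeries (PowerSeries 𝒪[F]),
      (∀ c : I, colemanDeltaCoinvFun hπ hq (intBase F) u hu γ (eq_zero_of_C_pi_mul_eq_zero_integer hπ) w hγ ε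
          (indexTraceₗ hπ hq u hu γ (colemanImage hd hπ E hmono hE hdeg hσ₀ hq u hu γ hθ hcoh
            (closure_unitsGen_subset_principalCoherentFamilies hπ E hmono β hβ (mem_closure_unitsGen hπ E β c)).1)) =
        (colemanDeltaCoinvFun hπ hq (intBase F) u hu γ (eq_zero_of_C_pi_mul_eq_zero_integer hπ) w hγ ε
            (unitTwistₗ hπ hq (intBase F) u hu γ (lubinTateChar hπ (σ c)) (TActModule.ofPS _ _ 1)) *
            PowerSeries.C (g c : PowerSeries 𝒪[F]) - PowerSeries.C ((n c : ℕ) : PowerSeries 𝒪[F])) * L) ∧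
      (L ≠ 0 → Module.charIdeal (PowerSeries (PowerSeries 𝒪[F]))
          (↥(unitsImageTrace hd hπ E hmono hE hdeg hσ₀ hq u hu γ hθ hcoh hI hud) ⧸
            colemanCoinvRel hπ hq (intBase F) u hu γ ε (unitsImageTrace hd hπ E hmono hE hdeg hσ₀ hq u hu γ hθ hcoh hI hud)
              (fun _ hG => unitTwistₗ_mem_unitsImageTrace hd hπ E hmono hE hdeg hσ₀ hq u hu γ hθ hcoh hI hud (-1) hG)
              (colemanImageTrace hd hπ E hmono hE hdeg hσ₀ hq u hu γ hθ hcoh hN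
                (closure (Submonoid.closure (Set.range β ∪ Set.range fun c => fun m => ((β c) m).inv hπ (E m)) :
                  Set (∀ m, RelNormCoherentUnits hπ (E m))))
                isClosed_closure (closure_unitsGen_subset_principalCoherentFamilies hπ E hmono β hβ) (one_mem_closure_unitsGen hπ E β)
                (mul_mem_closure_unitsGen hπ E β) (inv_mem_closure_unitsGen hπ E β)
                (galAct_mem_closure_unitsGen hπ E β (galAct_mem_closure_unitsGen_of_mul_rule hπ E hmono β σ happrox μ n hrule)))) =
        Ideal.span {L}) :=
  exists_charIdeal_coinvariants_colemanImageTrace_closure_eq_span_of_galois hd hπ E hmono hE hdeg hσ₀ hq u hu γ w hγ hθ hcoh hI hud hm hN β hβ ε σ g n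
    (galAct_mem_closure_unitsGen_of_mul_rule hπ E hmono β σ happrox μ n hrule) hε s hg
    (hrel_of_mul_rule hπ E β σ μ n hμ hrule) a₁ a₂ hv₁ hn₁ ha₂

end MulRule

end Summit.BirchSwinnertonDyer.BirchSwinnertonDyer.Theorems.PrintCf2.ColemanCoinvariantTraceArtin

end
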